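import Summits.QuantumFields.YangMills.Theorems.FluctuationComparisonRegPrIntLS2BetaLogChordComparison
import Summits.QuantumFields.YangMills.Theorems.FluctuationComparisonRegPrIntLS2BetaClosePairOfOneStep
import HarnessLib

/-!
# S2β · strata residue of GAP♯∘, the (D♮) REL-TEL road — THE CHART LETTER (L♭) ALONG THE TWO TOWERS FROM A DISPLAYED SUP PROFILE:
# `‖log U′_{j+1} − log U′₀_{j+1}‖_{ℓ²} ≤ (1 + s_{j+1}²∕3)·‖dist1(U′_{j+1}·U′₀_{j+1}⁻¹)‖_{ℓ²}` at every level, `Σ_j s_{j+1}²∕3 ≤ E` — the (L♭) half of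
# ✓p822621 `dockRel_inner`'s letter, with the top level free (the two towers AGREE there)

Cell `ym3-torus` (YM ladder rung R3 = continuum `SU(2)` Yang–Mills on the three-torus — a RUNG: NOT d = 4, NOT infinite volume, NOT a mass gap,
NOT Clay).  Width seat «width 12» `ym3-torus-px12` (gen 24), FREE px helper on crux `stmt-QuantumFields-20520`
(`Theses.UnitScaleTilt.FluctuationComparisonRegPrIntL`); `--kind proof --supports stmt-QuantumFields-20520 --as helper`, count-neutral, DEFINITION-FREE
(0 `def`, 0 `instance`, 0 `notation`, 0 `sorry`, default heartbeats).

WHAT.  ✓p822621 `…S2BetaRelGaugeOfRelativeLetter.dockRel_inner` ∕ `relGauge_of_letter` reduce the gauged distance letter (D♮) of ✓p821904 to ONE displayed two-tower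
letter with two profiles `r, e`; its chart half (L♭) reads, at every level `j < K−J`, `‖log U′_{j+1} − log U′₀_{j+1}‖_{ℓ²} ≤ (1 + r_j)·‖dist1(U′_{j+1}·U′₀_{j+1}⁻¹)‖_{ℓ²}`.
✓p822698 `…S2BetaLogChordComparison.sqrt_sum_sq_norm_logVec_sub_le` is that inequality at ONE level with `r := s²∕3` whenever every bond arc of both fields
is `≤ s`, `s² ≤ 3`.  THIS FILE threads it along the towers: given a SUP PROFILE `s` bounding the bond arcs of BOTH towers at the intermediate levels
`0 < t < m` (with `s_t² ≤ 3` there) and a budget `Σ_{j<m} s_{j+1}² ≤ 3E`, the (L♭) clause holds with `r_j := s_{j+1}²∕3`, `Σ_{j<m} r_j ≤ E` — the TOP level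
`t = m` needs NO bound because the two towers COINCIDE there (`U′_m = U′₀_m`: both equal the datum in the trivial top gauge), so `s_m` may be anything
(it only enters the budget).  UV3-NODE §84.3∕§84.4: the profile's START `s_{m−1}` is where the datum's own gauge enters (✓p822838 `…S2BetaDatumGaugeWLOG`);
the SUPPLIER of `s` (px17's ✓`exists_supProfile_relativeTower` ∕ ✓`…RelativeTowerSupBudget` generalised to a non-flat top, px16's ✓`sup_bootstrap` with a
small non-zero start) is NOT this file.
* §1 ★★ `chartLetter_of_supProfile` — abstract bond index types `ι t`, two families `U′ U′₀ : (t : ℕ) → ι t → SU(2)`, agreement at the top.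
* §2 `chartLetter_of_two_supProfiles` — one profile per tower (`s := max`), budgets add.
* §3 ★★ `chartLetter_along_towers` — the T³ reading on the stage towers of a fibre pair (`U′_t := g_t•M^tU`, `U′₀_t := g₀_t•M^tU₀`, `m := K − J`; the top
  agreement from ✓`iter_eq_of_mem_fibre` + (T1) twice): EXACTLY the (L♭) conjunct of ✓p822621's letter, from a displayed profile.

HONEST SCOPE.  Bookkeeping over ✓p822698; the profile `s` and its budget are HYPOTHESES (their supplier is named above, un-typed for a non-flat datum); nothing of
Bałaban's analysis is asserted ([Balaban1985RegularSpaces] (1.29) p.81: local axial-gauge geodesic charts); (L♭)'s supplier, (H♭), (D♮), (F♮), GAP♯∘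
(`stub_uniformFibreGapOrbit`), S2β, crux 20520 and `YM3TorusSU2` are NOT proved; no registered stub is closed; rung R3 = SU(2) YM₃ on T³ — NOT d = 4, NOT
infinite volume, NOT a mass gap, NOT Clay; the Yang–Mills mass gap is NOT proved.
-/

set_option autoImplicit false

noncomputable section

namespace Summit.QuantumFields.YangMills.Theorems.FluctuationComparisonRegPrIntLS2BetaChartLetterOfSupProfile

open Finset
open scoped Real
open Literature.MathematicalPhysics.QuantumLattice (su2Quat)
open Literature.MathematicalPhysics.QuantumFieldTheory.Balaban1983to89
open T4Continuum T3ContinuumYM3Torus T3UnitScaleTilt T3TiltDescent T3LevelShift BlockAveraging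
open T4CubeChartGnomonic (SU2)
open T4ExpWindowSmallField (logVec)
open T3UnitLawDensityEML (ℰp)
open T3ConstrainedMinimiser (fibre)
open Summit.QuantumFields.YangMills.Theorems.FluctuationComparisonRegPrIntLS2BetaLogChordComparison (sqrt_sum_sq_norm_logVec_sub_le)
open Summit.QuantumFields.YangMills.Theorems.FluctuationComparisonRegPrIntLS2BetaClosePairOfOneStep (iter_eq_of_mem_fibre)

/-! ## §1 The chart letter along two abstract towers from one sup profile -/

/-- ★★ **(L♭) ALONG THE TOWERS FROM A SUP PROFILE.**  Two families of bond fields `U′ U′₀` over abstract finite bond types `ι t`, agreeing at the top level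
`m`; a profile `s` with every bond arc of both fields `≤ s_t` and `s_t² ≤ 3` at the intermediate levels `0 < t < m`; budget `Σ_{j<m} s_{j+1}² ≤ 3E`.  Then
with `r_j := s_{j+1}²∕3`: `r ≥ 0`, `Σ_{j<m} r_j ≤ E`, and `‖log U′_{j+1} − log U′₀_{j+1}‖_{ℓ²} ≤ (1 + r_j)·‖dist1(U′_{j+1}·U′₀_{j+1}⁻¹)‖_{ℓ²}` for every `j < m`
(✓`sqrt_sum_sq_norm_logVec_sub_le` below the top; `0 ≤ …` at the top). [cite: Balaban1985RegularSpaces, (1.29) p.81] -/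
theorem chartLetter_of_supProfile {ι : ℕ → Type*} [∀ t, Fintype (ι t)] (m : ℕ) (U' U'₀ : (t : ℕ) → ι t → SU2) (s : ℕ → ℝ) (E : ℝ)
    (htop : ∀ b, U' m b = U'₀ m b)
    (hU : ∀ t, 0 < t → t < m → ∀ b, ‖logVec (su2Quat (U' t b))‖ ≤ s t)
    (hU₀ : ∀ t, 0 < t → t < m → ∀ b, ‖logVec (su2Quat (U'₀ t b))‖ ≤ s t)
    (hs3 : ∀ t, 0 < t → t < m → s t ^ 2 ≤ 3)
    (hE : ∑ j ∈ range m, s (j + 1) ^ 2 ≤ 3 * E) :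
    ∃ r : ℕ → ℝ, (∀ j, 0 ≤ r j) ∧ ∑ j ∈ range m, r j ≤ E ∧
      ∀ j, j < m →
        √(∑ b, ‖logVec (su2Quat (U' (j + 1) b)) - logVec (su2Quat (U'₀ (j + 1) b))‖ ^ 2) ≤
          (1 + r j) * √(∑ b, dist1 (U' (j + 1) b * (U'₀ (j + 1) b)⁻¹) ^ 2) := by
  refine ⟨fun j => s (j + 1) ^ 2 / 3, fun j => by positivity, ?_, fun j hj => ?_⟩
  · rw [← sum_div, div_le_iff₀ (by norm_num : (0 : ℝ) < 3)]
    linarith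
  · rcases Nat.lt_or_ge (j + 1) m with hjm | hjm
    · exact sqrt_sum_sq_norm_logVec_sub_le univ (U' (j + 1)) (U'₀ (j + 1))
        (fun b _ => hU (j + 1) (Nat.succ_pos j) hjm b) (fun b _ => hU₀ (j + 1) (Nat.succ_pos j) hjm b) (hs3 (j + 1) (Nat.succ_pos j) hjm)
    · -- the top: the two towers coincide
      have hm : j + 1 = m := le_antisymm hj hjm
      subst hm
      have h0 : ∑ b, ‖logVec (su2Quat (U' (j + 1) b)) - logVec (su2Quat (U'₀ (j + 1) b))‖ ^ 2 = 0 :=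
        sum_eq_zero fun b _ => by rw [htop b, sub_self, norm_zero]; ring
      rw [h0, Real.sqrt_zero]
      exact mul_nonneg (by positivity) (Real.sqrt_nonneg _)

/-! ## §2 One profile per tower -/

/-- **TWO PROFILES**: if `s¹` bounds the arcs of `U′` and `s²` those of `U′₀` (intermediate levels; squares `≤ 3`), then §1 runs with
`s := max s¹ s²` and budget `Σ (s¹_{j+1}² + s²_{j+1}²) ≤ 3E`. [cite: Balaban1985RegularSpaces, (1.29) p.81] -/
theorem chartLetter_of_two_supProfiles {ι : ℕ → Type*} [∀ t, Fintype (ι t)] (m : ℕ) (U' U'₀ : (t : ℕ) → ι t → SU2) (s₁ s₂ : ℕ → ℝ) (E : ℝ)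
    (htop : ∀ b, U' m b = U'₀ m b)
    (hU : ∀ t, 0 < t → t < m → ∀ b, ‖logVec (su2Quat (U' t b))‖ ≤ s₁ t)
    (hU₀ : ∀ t, 0 < t → t < m → ∀ b, ‖logVec (su2Quat (U'₀ t b))‖ ≤ s₂ t)
    (h3₁ : ∀ t, 0 < t → t < m → s₁ t ^ 2 ≤ 3) (h3₂ : ∀ t, 0 < t → t < m → s₂ t ^ 2 ≤ 3)
    (hE : ∑ j ∈ range m, (s₁ (j + 1) ^ 2 + s₂ (j + 1) ^ 2) ≤ 3 * E) :
    ∃ r : ℕ → ℝ, (∀ j, 0 ≤ r j) ∧ ∑ j ∈ range m, r j ≤ E ∧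
      ∀ j, j < m →
        √(∑ b, ‖logVec (su2Quat (U' (j + 1) b)) - logVec (su2Quat (U'₀ (j + 1) b))‖ ^ 2) ≤
          (1 + r j) * √(∑ b, dist1 (U' (j + 1) b * (U'₀ (j + 1) b)⁻¹) ^ 2) := by
  have hmax : ∀ t, max (s₁ t) (s₂ t) ^ 2 ≤ s₁ t ^ 2 + s₂ t ^ 2 := fun t => by
    rcases le_total (s₁ t) (s₂ t) with h | h
    · rw [max_eq_right h]; nlinarith [sq_nonneg (s₁ t)]
    · rw [max_eq_left h]; nlinarith [sq_nonneg (s₂ t)]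
  refine chartLetter_of_supProfile m U' U'₀ (fun t => max (s₁ t) (s₂ t)) E htop
    (fun t h0 ht b => (hU t h0 ht b).trans (le_max_left _ _)) (fun t h0 ht b => (hU₀ t h0 ht b).trans (le_max_right _ _))
    (fun t h0 ht => ?_) ((sum_le_sum fun j _ => hmax (j + 1)).trans hE)
  rcases le_total (s₁ t) (s₂ t) with h | h
  · rw [max_eq_right h]; exact h3₂ t h0 ht
  · rw [max_eq_left h]; exact h3₁ t h0 ht

/-! ## §3 The T³ reading on the two stage towers of a fibre pair -/

variable (F : T3Family) {J K : ℕ}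

/-- ★★ **(L♭) ALONG THE TWO STAGE TOWERS OF A FIBRE PAIR** — EXACTLY the chart conjunct of ✓p822621 `dockRel_inner`'s displayed letter, from ONE displayed
sup profile `s`: for `U, U₀ ∈ fibre(V)` and gauge families `g, g₀` trivial above `K − J` ((T1) twice), if every bond arc of `g_t•M^tU` and of `g₀_t•M^tU₀`
is `≤ s_t` with `s_t² ≤ 3` at the levels `0 < t < K − J`, and `Σ_{j<K−J} s_{j+1}² ≤ 3E`, then `∃ r ≥ 0, Σ_{j<K−J} r_j ≤ E` with
`‖log U′_{j+1} − log U′₀_{j+1}‖_{ℓ²} ≤ (1 + r_j)·‖dist1(U′_{j+1}·U′₀_{j+1}⁻¹)‖_{ℓ²}` for all `j < K − J` (the top agreement is ✓`iter_eq_of_mem_fibre` + (T1)).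
[cite: Balaban1985RegularSpaces, (1.29) p.81; Balaban1985Variational, (4) p.278] -/
theorem chartLetter_along_towers (hJK : J ≤ K) {V : GaugeField (F.P J) 0 SU2}
    (U U₀ : GaugeField (F.P K) 0 SU2) (hU : U ∈ fibre F ℰp J K hJK V) (hU₀ : U₀ ∈ fibre F ℰp J K hJK V)
    (g g₀ : (j : ℕ) → Site (F.P K) j → SU2)
    (hT1 : ∀ j, K - J ≤ j → ∀ y, g j y = 1) (hT1' : ∀ j, K - J ≤ j → ∀ y, g₀ j y = 1)
    (s : ℕ → ℝ) (E : ℝ)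
    (hs : ∀ t, 0 < t → t < K - J → ∀ b,
      ‖logVec (su2Quat (GaugeField.gaugeAct (g t) (Averaging.iter (fun k => blockAvg (P := F.P K) (j := k) ℰp) t U) b))‖ ≤ s t)
    (hs₀ : ∀ t, 0 < t → t < K - J → ∀ b,
      ‖logVec (su2Quat (GaugeField.gaugeAct (g₀ t) (Averaging.iter (fun k => blockAvg (P := F.P K) (j := k) ℰp) t U₀) b))‖ ≤ s t)
    (hs3 : ∀ t, 0 < t → t < K - J → s t ^ 2 ≤ 3)
    (hE : ∑ j ∈ range (K - J), s (j + 1) ^ 2 ≤ 3 * E) :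
    ∃ r : ℕ → ℝ, (∀ j, 0 ≤ r j) ∧ ∑ j ∈ range (K - J), r j ≤ E ∧
      ∀ j, j < K - J →
        √(∑ b, ‖logVec (su2Quat (GaugeField.gaugeAct (g (j + 1)) (Averaging.iter (fun k => blockAvg (P := F.P K) (j := k) ℰp) (j + 1) U) b)) -
              logVec (su2Quat (GaugeField.gaugeAct (g₀ (j + 1)) (Averaging.iter (fun k => blockAvg (P := F.P K) (j := k) ℰp) (j + 1) U₀) b))‖ ^ 2) ≤
          (1 + r j) * √(∑ b, dist1 (GaugeField.gaugeAct (g (j + 1)) (Averaging.iter (fun k => blockAvg (P := F.P K) (j := k) ℰp) (j + 1) U) b *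
              (GaugeField.gaugeAct (g₀ (j + 1)) (Averaging.iter (fun k => blockAvg (P := F.P K) (j := k) ℰp) (j + 1) U₀) b)⁻¹) ^ 2) := by
  refine chartLetter_of_supProfile (ι := fun t => PBond (F.P K) t) (K - J)
    (fun t => GaugeField.gaugeAct (g t) (Averaging.iter (fun k => blockAvg (P := F.P K) (j := k) ℰp) t U))
    (fun t => GaugeField.gaugeAct (g₀ t) (Averaging.iter (fun k => blockAvg (P := F.P K) (j := k) ℰp) t U₀)) s E (fun b => ?_) hs hs₀ hs3 hE
  -- the top: same field (one fibre) and trivial gauges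
  have h1 : Averaging.iter (fun k => blockAvg (P := F.P K) (j := k) ℰp) (K - J) U =
      Averaging.iter (fun k => blockAvg (P := F.P K) (j := k) ℰp) (K - J) U₀ := iter_eq_of_mem_fibre F hJK hU hU₀
  have hg : g (K - J) = fun _ => 1 := funext (hT1 (K - J) le_rfl)
  have hg' : g₀ (K - J) = fun _ => 1 := funext (hT1' (K - J) le_rfl)
  simp only [h1, hg, hg']

end Summit.QuantumFields.YangMills.Theorems.FluctuationComparisonRegPrIntLS2BetaChartLetterOfSupProfile

end
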